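import Summits.QuantumFields.YangMills.Theorems.LuscherReductionDressedRitzPolyakovLiftEuclideanCurrency
import Summits.QuantumFields.YangMills.Theorems.LuscherReductionDressedRitzPolyakovLiftDressed
import HarnessLib

/-!
# Crux `DressedRitz` (stmt-QuantumFields-20205), line «polyakovlift» r5, stub S-LEAK `stub_liftLeakage` — support XII:
# the leakage clause (o4) in EUCLIDEAN CURRENCY — the log-convexity defect of the normalised connected flowed-Polyakov autocorrelation at `t = 2L+1`

Support module (fleet seat ym-20205-polyakovlift-s1 gen 1; `--supports stmt-QuantumFields-20205`, helper, no closure claim) for the registered stub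
`Summit.QuantumFields.YangMills.Cruxes.DressedRitz.PolyakovLift.stub_liftLeakage` (skeleton r5, sha16 8b6782afbcc2a19a): clause (o4)
`‖K_βu_i‖²‖u_i‖² − ⟨u_i,K_βu_i⟩² ≤ C(λ³/L²)λ₀²‖u_i‖⁴` for the DRESSED lifted channel vectors `u_i = K_β^[m](ins φ G_i)`, `m = dressSteps L = L`,
`G_i = flowLiftAt 0 (flowTime β L) g_i`.  Twin, for S-LEAK, of the lead's Euclidean currency of S-UNIV′ (`…PolyakovLiftEuclideanCurrency.lean`, p537143:
`corr β φ G t i l = ⟨ins φ G_i, K_β^[t](ins φ G_l)⟩/λ₀^t`, `l2_iterate_polar`, `corr_dressed_norm ∕ _form`).  Moving the dressing across: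

  `‖u_i‖² = λ₀^{2m}·c(2m)`, `⟨u_i,K_βu_i⟩ = λ₀^{2m+1}·c(2m+1)`, `‖K_βu_i‖² = λ₀^{2m+2}·c(2m+2)`  (`c(t) = corr β φ G t i i`),

so (o4) for `u_i` IS, after division by `λ₀^{4m+2} > 0`, the dimensionless
  (E4)  `c(2m+2)·c(2m) − c(2m+1)² ≤ C(λ³/L²)·c(2m)²`
— the LOG-CONVEXITY DEFECT of the vacuum-energy-normalised connected autocorrelation `t ↦ c(t)` of the flowed Polyakov eigen-ratio insertion at
Euclidean separation `t = 2L+1` is `O(λ³/L²)` relative: the EFFECTIVE MASS `−log(c(t+1)/c(t))` (non-increasing in `t` by `corr_logConvex`) drifts by at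
most `O(λ³/L²)` between the steps `2L → 2L+1 → 2L+2`, while it sits at `≈ ε_{i+1}λ/L` — single-state dominance of the channel at time `2L`.  By the vacuum
dictionary every `c(t)` is an `m' → ∞` limit of free-boundary slab ratios (lead's `tendsto_corr`), i.e. (E4) is a statement about ratios of finite-volume
Euclidean path integrals on `L³ × T` with two insertions, uniformly in `T` — the form a Bałaban-type small-field expansion consumes.

* `corr_dressed_normSq_apply` — `‖K_β(K_β^[m] ins φ G_i)‖² = λ₀^{2m+2}·corr(2m+2)_{ii}`;
* `corr_logConvex` — `corr(2m+1)_{ii}² ≤ corr(2m)_{ii}·corr(2m+2)_{ii}` (Cauchy–Schwarz; the defect in (E4) is `≥ 0`);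
* `leakage_lhs_eq` — the (o4) variance of `u_i` equals `λ₀^{4m+2}·(c(2m+2)c(2m) − c(2m+1)²)`, its right-hand side `C(λ³/L²)λ₀²‖u_i‖⁴ = λ₀^{4m+2}·C(λ³/L²)c(2m)²`;
* `EuclideanLeakageAt k` — (E4) deep in the window for every raw vacuum and every lift basis (same quantifier prefix as the stub);
* ★ `leakageClause_iff_euclidean` (per lattice point) and ★★ `liftLeakage_iff_euclidean` : `(∀ k, EuclideanLeakageAt k) ↔` the r5 text of
  `Stmt.stub_liftLeakage` VERBATIM (same `C`, same `lam0`, same `L0`).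

HONEST FRAMING: fixed-lattice bookkeeping on the conditional femto rung R2b1; `stub_liftLeakage` stays OPEN ((E4) is the open renormalisation-group
estimate, restated); nothing here bears on infinite volume, the continuum limit or the Clay gap.
References: M. Lüscher, U. Wolff, NPB 339 (1990) 222 [cite: LuscherWolff1990, §2]; T. Kato, J. Phys. Soc. Japan 4 (1949) 334 [cite: Kato1949, §1];
M. Lüscher, NPB 219 (1983) 233 [cite: Luscher1983, §3].
-/

set_option autoImplicit false

noncomputable section

open MeasureTheory Filter Topology Real
open Literature.MathematicalPhysics.QuantumFieldTheory (GaugeConfig Site gaugeTransform)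
open scoped BigOperators

namespace Summit.QuantumFields.YangMills.Theorems.FemtoTransferGap.LiftLeak

open Summit.QuantumFields.YangMills.Theorems.FemtoTransferGap
open Summit.QuantumFields.YangMills.Theorems.FemtoTransferGap.PolyakovLift

/-! ## §1 The third dressed number and log-convexity -/

/-- **Two-step number of an `m`-dressed insertion**: `‖K_β(K_β^[m] ins φ G_i)‖² = λ₀^{2m+2}·corr(2m+2)_{ii}`. [cite: LuscherWolff1990, §2] -/
theorem corr_dressed_normSq_apply {M : ℕ} [NeZero M] {k : ℕ} {β : ℝ} (hβ : 0 < β) {φ : GaugeConfig 3 M SU2 → ℝ} (hφ : IsPhys φ)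
    {G : Fin k → (GaugeConfig 3 M SU2 → ℝ)} (hG : ∀ i, IsPhys (G i)) (m : ℕ) (i : Fin k) :
    l2 (transferApply β ((transferApply (L := M) β)^[m] (OpPlat.ins φ (G i))))
        (transferApply β ((transferApply β)^[m] (OpPlat.ins φ (G i)))) =
      levelValue su2Rep M β 0 ^ (2 * m + 2) * corr β φ G (2 * m + 2) i i := by
  rw [← Function.iterate_succ_apply' (transferApply β) m, corr_dressed_norm hβ hφ hG (m + 1) i i,
    show 2 * (m + 1) = 2 * m + 2 by ring]

/-- **Log-convexity of the autocorrelation**: `corr(2m+1)_{ii}² ≤ corr(2m)_{ii}·corr(2m+2)_{ii}` (Cauchy–Schwarz `⟨v,K_βv⟩² ≤ ‖v‖²‖K_βv‖²` for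
`v = K_β^[m] ins φ G_i`); equivalently the effective mass `−log(corr(t+1)/corr(t))` does not increase from `t = 2m` to `t = 2m+1`. [cite: LuscherWolff1990, §2] -/
theorem corr_logConvex {M : ℕ} [NeZero M] {k : ℕ} {β : ℝ} (hβ : 0 < β) {φ : GaugeConfig 3 M SU2 → ℝ} (hφ : IsPhys φ)
    {G : Fin k → (GaugeConfig 3 M SU2 → ℝ)} (hG : ∀ i, IsPhys (G i)) (m : ℕ) (i : Fin k) :
    corr β φ G (2 * m + 1) i i ^ 2 ≤ corr β φ G (2 * m) i i * corr β φ G (2 * m + 2) i i := by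
  set v := (transferApply (L := M) β)^[m] (OpPlat.ins φ (G i)) with hv
  have hvP : IsPhys v := isPhys_iterate_transferApply β (OpPlat.isPhys_ins hφ (hG i)) m
  have hcs := sq_l2_le hvP (isPhys_transferApply β hvP)
  rw [hv, corr_dressed_form hβ hφ hG m i i, corr_dressed_norm hβ hφ hG m i i, corr_dressed_normSq_apply hβ hφ hG m i] at hcs
  have hl0 : 0 < levelValue su2Rep M β 0 := levelValue_su2Rep_pos hβ 0
  have hP : 0 < levelValue su2Rep M β 0 ^ (4 * m + 2) := pow_pos hl0 _
  have hcs' : levelValue su2Rep M β 0 ^ (4 * m + 2) * corr β φ G (2 * m + 1) i i ^ 2 ≤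
      levelValue su2Rep M β 0 ^ (4 * m + 2) * (corr β φ G (2 * m) i i * corr β φ G (2 * m + 2) i i) := by
    have e1 : (levelValue su2Rep M β 0 ^ (2 * m + 1) * corr β φ G (2 * m + 1) i i) ^ 2 =
        levelValue su2Rep M β 0 ^ (4 * m + 2) * corr β φ G (2 * m + 1) i i ^ 2 := by
      rw [mul_pow, ← pow_mul]; ring_nf
    have e2 : levelValue su2Rep M β 0 ^ (2 * m) * corr β φ G (2 * m) i i * (levelValue su2Rep M β 0 ^ (2 * m + 2) * corr β φ G (2 * m + 2) i i) =
        levelValue su2Rep M β 0 ^ (4 * m + 2) * (corr β φ G (2 * m) i i * corr β φ G (2 * m + 2) i i) := by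
      rw [show 4 * m + 2 = 2 * m + (2 * m + 2) by ring, pow_add]; ring
    rw [← e1, ← e2]; exact hcs
  exact le_of_mul_le_mul_left hcs' hP

/-! ## §2 (o4) for a dressed insertion ⟺ the Euclidean clause (E4) -/

/-- **The (o4) data of an `m`-dressed insertion in Euclidean currency**: with `u = K_β^[m] ins φ G_i` and `c(t) = corr β φ G t i i`,
`‖K_βu‖²‖u‖² − ⟨u,K_βu⟩² = λ₀^{4m+2}·(c(2m+2)c(2m) − c(2m+1)²)` and `C(λ³/L²)λ₀²‖u‖⁴ = λ₀^{4m+2}·(C(λ³/L²)c(2m)²)`. [cite: LuscherWolff1990, §2] -/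
theorem leakage_lhs_eq {M : ℕ} [NeZero M] {k : ℕ} {β : ℝ} (hβ : 0 < β) {φ : GaugeConfig 3 M SU2 → ℝ} (hφ : IsPhys φ)
    {G : Fin k → (GaugeConfig 3 M SU2 → ℝ)} (hG : ∀ i, IsPhys (G i)) (m : ℕ) (i : Fin k) (C : ℝ) :
    l2 (transferApply β ((transferApply (L := M) β)^[m] (OpPlat.ins φ (G i)))) (transferApply β ((transferApply β)^[m] (OpPlat.ins φ (G i)))) *
          l2 ((transferApply β)^[m] (OpPlat.ins φ (G i))) ((transferApply β)^[m] (OpPlat.ins φ (G i))) -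
        l2 ((transferApply β)^[m] (OpPlat.ins φ (G i))) (transferApply β ((transferApply β)^[m] (OpPlat.ins φ (G i)))) ^ 2 =
      levelValue su2Rep M β 0 ^ (4 * m + 2) * (corr β φ G (2 * m + 2) i i * corr β φ G (2 * m) i i - corr β φ G (2 * m + 1) i i ^ 2) ∧
    C * (luscherLambda β M ^ 3 / (M : ℝ) ^ 2) * levelValue su2Rep M β 0 ^ 2 *
        l2 ((transferApply β)^[m] (OpPlat.ins φ (G i))) ((transferApply β)^[m] (OpPlat.ins φ (G i))) ^ 2 =
      levelValue su2Rep M β 0 ^ (4 * m + 2) * (C * (luscherLambda β M ^ 3 / (M : ℝ) ^ 2) * corr β φ G (2 * m) i i ^ 2) := by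
  rw [corr_dressed_form hβ hφ hG m i i, corr_dressed_norm hβ hφ hG m i i, corr_dressed_normSq_apply hβ hφ hG m i]
  constructor
  · rw [show 4 * m + 2 = (2 * m + 2) + 2 * m by ring, pow_add, show (2 * m + 2) = (2 * m + 1) + 1 by ring, pow_succ]
    ring
  · rw [show 4 * m + 2 = 2 + 2 * m + 2 * m by ring, pow_add, pow_add]
    ring

/-- ★ **(o4) for an `m`-dressed insertion ⟺ (E4)** (`β > 0`; division by `λ₀^{4m+2} > 0`). [cite: LuscherWolff1990, §2] [cite: Kato1949, §1] -/
theorem leakage_iff_euclidean_one {M : ℕ} [NeZero M] {k : ℕ} {β : ℝ} (hβ : 0 < β) {φ : GaugeConfig 3 M SU2 → ℝ} (hφ : IsPhys φ)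
    {G : Fin k → (GaugeConfig 3 M SU2 → ℝ)} (hG : ∀ i, IsPhys (G i)) (m : ℕ) (i : Fin k) (C : ℝ) :
    l2 (transferApply β ((transferApply (L := M) β)^[m] (OpPlat.ins φ (G i)))) (transferApply β ((transferApply β)^[m] (OpPlat.ins φ (G i)))) *
          l2 ((transferApply β)^[m] (OpPlat.ins φ (G i))) ((transferApply β)^[m] (OpPlat.ins φ (G i))) -
        l2 ((transferApply β)^[m] (OpPlat.ins φ (G i))) (transferApply β ((transferApply β)^[m] (OpPlat.ins φ (G i)))) ^ 2 ≤
      C * (luscherLambda β M ^ 3 / (M : ℝ) ^ 2) * levelValue su2Rep M β 0 ^ 2 *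
        l2 ((transferApply β)^[m] (OpPlat.ins φ (G i))) ((transferApply β)^[m] (OpPlat.ins φ (G i))) ^ 2 ↔
    corr β φ G (2 * m + 2) i i * corr β φ G (2 * m) i i - corr β φ G (2 * m + 1) i i ^ 2 ≤
      C * (luscherLambda β M ^ 3 / (M : ℝ) ^ 2) * corr β φ G (2 * m) i i ^ 2 := by
  obtain ⟨h1, h2⟩ := leakage_lhs_eq hβ hφ hG m i C
  rw [h1, h2]
  exact mul_le_mul_iff_right₀ (pow_pos (levelValue_su2Rep_pos hβ 0) _)

/-! ## §3 The Euclidean form of S-LEAK and the equivalence with the registered text -/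

/-- **`EuclideanLeakageAt k`** — S-LEAK in Euclidean currency: deep in the femto window, for every raw vacuum `φ` and every lift basis `(ω, g)` at
`B₁ = liftCoupling β L`, with `c = corr β φ (flowLiftAt 0 (flowTime β L) ∘ g)` and `m = dressSteps L`: for every channel `i`,
(E4) `c(2m+2)_{ii}·c(2m)_{ii} − c(2m+1)_{ii}² ≤ C(λ³/L²)·c(2m)_{ii}²` — the log-convexity defect of the normalised connected flowed-Polyakov autocorrelation at
separation `2L+1` is `O(λ³/L²)` relative (no power of the top value appears). [cite: LuscherWolff1990, §2] [cite: Luscher1983, §3] -/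
def EuclideanLeakageAt (k : ℕ) : Prop :=
  ∃ C lam0 : ℝ, 0 ≤ C ∧ 0 < lam0 ∧ ∀ lam : ℝ, 0 < lam → lam ≤ lam0 → ∃ L0 : ℕ,
    ∀ (L : ℕ) [NeZero L], L0 ≤ L → ∀ β : ℝ, InFemtoWindow lam β L →
      ∀ φ : GaugeConfig 3 L SU2 → ℝ, IsRawVacuum β φ →
        ∀ (ω : GaugeConfig 3 1 SU2 → ℝ) (g : Fin k → (GaugeConfig 3 1 SU2 → ℝ)), LiftBasis (liftCoupling β L) k ω g →
          let c := corr β φ (fun i => flowLiftAt (L := L) 0 (flowTime β L) (g i))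
          let m := dressSteps L
          ∀ i : Fin k, c (2 * m + 2) i i * c (2 * m) i i - c (2 * m + 1) i i ^ 2 ≤ C * (luscherLambda β L ^ 3 / (L : ℝ) ^ 2) * c (2 * m) i i ^ 2

/-- ★ **Per lattice point: `LeakageClause k C β (dressedLiftFamily β φ g)` ⟺ (E4) for every channel** (`β > 0`, `φ` and the `g_i` physical).
[cite: LuscherWolff1990, §2] [cite: Kato1949, §1] -/
theorem leakageClause_iff_euclidean {L : ℕ} [NeZero L] {k : ℕ} {C β : ℝ} (hβ : 0 < β) {φ : GaugeConfig 3 L SU2 → ℝ} (hφ : IsPhys φ)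
    {g : Fin k → (GaugeConfig 3 1 SU2 → ℝ)} (hg : ∀ i, IsPhys (g i)) :
    LeakageClause k C β (dressedLiftFamily β φ g) ↔
      ∀ i : Fin k,
        corr β φ (fun i => flowLiftAt (L := L) 0 (flowTime β L) (g i)) (2 * dressSteps L + 2) i i *
              corr β φ (fun i => flowLiftAt (L := L) 0 (flowTime β L) (g i)) (2 * dressSteps L) i i -
            corr β φ (fun i => flowLiftAt (L := L) 0 (flowTime β L) (g i)) (2 * dressSteps L + 1) i i ^ 2 ≤
          C * (luscherLambda β L ^ 3 / (L : ℝ) ^ 2) *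
            corr β φ (fun i => flowLiftAt (L := L) 0 (flowTime β L) (g i)) (2 * dressSteps L) i i ^ 2 := by
  have hG : ∀ i, IsPhys (flowLiftAt (L := L) 0 (flowTime β L) (g i)) := fun i => isPhys_flowLiftAt 0 _ (hg i)
  unfold LeakageClause
  exact forall_congr' fun i => leakage_iff_euclidean_one hβ hφ hG (dressSteps L) i C

/-- ★★ **`(∀ k, EuclideanLeakageAt k)` ⟺ the registered r5 text of `Stmt.stub_liftLeakage`** (verbatim over the tree objects; same constants).
[cite: LuscherWolff1990, §2] [cite: Luscher1983, §3] -/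
theorem liftLeakage_iff_euclidean :
    (∀ k : ℕ, EuclideanLeakageAt k) ↔
    ∀ k : ℕ, ∃ C lam0 : ℝ, 0 ≤ C ∧ 0 < lam0 ∧ ∀ lam : ℝ, 0 < lam → lam ≤ lam0 → ∃ L0 : ℕ,
      ∀ (L : ℕ) [NeZero L], L0 ≤ L → ∀ β : ℝ, InFemtoWindow lam β L →
        ∀ φ : GaugeConfig 3 L SU2 → ℝ, IsRawVacuum β φ →
          ∀ (ω : GaugeConfig 3 1 SU2 → ℝ) (g : Fin k → (GaugeConfig 3 1 SU2 → ℝ)), LiftBasis (liftCoupling β L) k ω g →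
            LeakageClause k C β (dressedLiftFamily β φ g) := by
  refine forall_congr' fun k => ?_
  unfold EuclideanLeakageAt
  refine exists_congr fun C => exists_congr fun lam0 => and_congr_right fun _ => and_congr_right fun _ => ?_
  refine forall_congr' fun lam => forall_congr' fun hlam => forall_congr' fun _ => exists_congr fun L0 => ?_
  refine forall_congr' fun L => forall_congr' fun _ => forall_congr' fun _ => forall_congr' fun β => forall_congr' fun hW => ?_
  refine forall_congr' fun φ => forall_congr' fun hφ => forall_congr' fun ω => forall_congr' fun g => forall_congr' fun hbasis => ?_
  have hβ : 0 < β := zero_lt_one.trans_le hW.1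
  exact (leakageClause_iff_euclidean (C := C) hβ hφ.1 hbasis.2.2.2.2.1).symm

end Summit.QuantumFields.YangMills.Theorems.FemtoTransferGap.LiftLeak

end
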